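import Mathlib
import HarnessLib
import Literature.Analysis.ODE.GrassmannConvexity
import Summits.ValiantsHypothesis.ValiantsHypothesis.Theorems.KPlusLogSqLawWeakLiftingTowerGraftWronskianGrassmannConvexity
import Summits.ValiantsHypothesis.ValiantsHypothesis.Theorems.KPlusLogSqLawWeakLiftingTowerGraftWronskianAlternantLawDefs

/-!
# Tower graft line — THE ALTERNANT LAW AT `K = 4` FROM THE GRASSMANN CONVEXITY THEOREM (`k = 2`)

Helper file for LINE (B) `Cruxes/WeakLifting/Lines/tower_graft.lean` (crux `WeakLifting` = stmt-ValiantsHypothesis-19561).  Hand g12 NAMED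
the alternant law `AlternantLawFour` (`…WronskianAlternantLawDefs`: for `0 < r₀ < ⋯ < r₄` and supports `d₀ < d₁ < d₂ < d₃` with
`d₀ + d₃ < d₁ + d₂`, the generalized-Vandermonde identity `A₁A₄·w₁w₃ = A₀A₅·w₂w₃ + A₂A₃·w₁w₂` never holds) and PROVED it equivalent to
Conjecture W at `K = 4`; its memo left «prove monomial positivity (MP) for all supports» as the repair census.  Hand g13 located Conjecture W
(every `K`) as a corollary of the PUBLISHED Grassmann convexity theorem for `k = 2` [Saldanha–Shapiro–Shapiro, Mosc. Math. J. 21 (2021)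
613–637, Theorem 1] (`…WronskianGrassmannConvexity.conjectureW_of_grassmannConvexityTwo`, conditional on the tree fact
`Literature.Analysis.ODE.GrassmannConvexityTwo`).  Hence:

* ★ `alternantLawFour_of_grassmannConvexityTwo` — the alternant law at `K = 4` holds, conditionally on the cited theorem;
* `alternant_lt_or_gt_of_grassmannConvexityTwo` — pointwise form: for every admissible configuration the two sides differ.

HONEST FRAMING: conditional on a cited, unformalised theorem; the combinatorial strengthening (MP) of g12's memo (monomial positivity of
`P_d = w₂w₃·s_{λ(0)}s_{λ(5)} + w₁w₂·s_{λ(2)}s_{λ(3)} − w₁w₃·s_{λ(1)}s_{λ(4)}`) is NOT implied and stays open; nothing here bears on S4/S4f/S5/S5ᴸ,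
TowerB, `WeakLifting`, Conjecture B, `MatrixDescartes` (18050) or `VP ≠ VNP`.  Def-free.  Seat: prover leafhand-val-kpluslogsqlaw-1 g13,
`--supports stmt-ValiantsHypothesis-19561 --as helper`.  [cite: SaldanhaShapiroShapiro2021, Theorem 1; the reduction is g12's]
-/

-- `Summit.ValiantsHypothesis.ValiantsHypothesis.…` repeats a component by the D-0017 layout
-- (single-conjunct summit), which the `dupNamespace` linter flags; the name is mandated.
set_option linter.dupNamespace false
set_option autoImplicit false

namespace Summit.ValiantsHypothesis.ValiantsHypothesis.Theorems.KPlusLogSqLaw.TowerGraft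

open Polynomial Finset
open scoped BigOperators Polynomial
open Literature.LinearAlgebra.Matrix.GeneralizedVandermonde (genVandermonde)

namespace WronskianDevelopable

/-- ★ **THE ALTERNANT LAW AT `K = 4` holds, conditionally on the Grassmann convexity theorem for `k = 2`.**
[cite: SaldanhaShapiroShapiro2021, Theorem 1] (via `alternantLawFour_iff_conjectureWAt_four`, g12) -/
theorem alternantLawFour_of_grassmannConvexityTwo (hGC : Literature.Analysis.ODE.GrassmannConvexityTwo) : AlternantLawFour :=
  alternantLawFour_iff_conjectureWAt_four.mpr (conjectureWAt_of_grassmannConvexityTwo hGC 4)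

/-- pointwise form: for `0 < r₀ < ⋯ < r₄`, `d₀ < d₁ < d₂ < d₃`, `d₀ + d₃ < d₁ + d₂`, the two sides of the alternant identity differ
(conditionally on the cited theorem). [cite: SaldanhaShapiroShapiro2021, Theorem 1] -/
theorem alternant_lt_or_gt_of_grassmannConvexityTwo (hGC : Literature.Analysis.ODE.GrassmannConvexityTwo)
    (r : Fin 5 → ℝ) (hr : StrictMono r) (hr0 : ∀ m, 0 < r m) (d : Fin 4 → ℕ) (hd : StrictMono d) (hA : d 0 + d 3 < d 1 + d 2) :
    (genVandermonde r ![d 0 + d 1, d 0 + d 3, d 1 + d 2, d 1 + d 3, d 2 + d 3]).det *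
          (genVandermonde r ![d 0 + d 1, d 0 + d 2, d 0 + d 3, d 1 + d 2, d 2 + d 3]).det *
          ((((d 1 : ℝ) - d 0) * ((d 3 : ℝ) - d 2)) * (((d 3 : ℝ) - d 0) * ((d 2 : ℝ) - d 1))) <
        (genVandermonde r ![d 0 + d 2, d 0 + d 3, d 1 + d 2, d 1 + d 3, d 2 + d 3]).det *
            (genVandermonde r ![d 0 + d 1, d 0 + d 2, d 0 + d 3, d 1 + d 2, d 1 + d 3]).det *
            ((((d 2 : ℝ) - d 0) * ((d 3 : ℝ) - d 1)) * (((d 3 : ℝ) - d 0) * ((d 2 : ℝ) - d 1))) +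
          (genVandermonde r ![d 0 + d 1, d 0 + d 2, d 1 + d 2, d 1 + d 3, d 2 + d 3]).det *
            (genVandermonde r ![d 0 + d 1, d 0 + d 2, d 0 + d 3, d 1 + d 3, d 2 + d 3]).det *
            ((((d 1 : ℝ) - d 0) * ((d 3 : ℝ) - d 2)) * (((d 2 : ℝ) - d 0) * ((d 3 : ℝ) - d 1))) ∨
      (genVandermonde r ![d 0 + d 2, d 0 + d 3, d 1 + d 2, d 1 + d 3, d 2 + d 3]).det *
            (genVandermonde r ![d 0 + d 1, d 0 + d 2, d 0 + d 3, d 1 + d 2, d 1 + d 3]).det *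
            ((((d 2 : ℝ) - d 0) * ((d 3 : ℝ) - d 1)) * (((d 3 : ℝ) - d 0) * ((d 2 : ℝ) - d 1))) +
          (genVandermonde r ![d 0 + d 1, d 0 + d 2, d 1 + d 2, d 1 + d 3, d 2 + d 3]).det *
            (genVandermonde r ![d 0 + d 1, d 0 + d 2, d 0 + d 3, d 1 + d 3, d 2 + d 3]).det *
            ((((d 1 : ℝ) - d 0) * ((d 3 : ℝ) - d 2)) * (((d 2 : ℝ) - d 0) * ((d 3 : ℝ) - d 1))) <
        (genVandermonde r ![d 0 + d 1, d 0 + d 3, d 1 + d 2, d 1 + d 3, d 2 + d 3]).det *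
          (genVandermonde r ![d 0 + d 1, d 0 + d 2, d 0 + d 3, d 1 + d 2, d 2 + d 3]).det *
          ((((d 1 : ℝ) - d 0) * ((d 3 : ℝ) - d 2)) * (((d 3 : ℝ) - d 0) * ((d 2 : ℝ) - d 1))) :=
  lt_or_gt_of_ne (alternantLawFour_of_grassmannConvexityTwo hGC r hr hr0 d hd hA)

end WronskianDevelopable

end Summit.ValiantsHypothesis.ValiantsHypothesis.Theorems.KPlusLogSqLaw.TowerGraft
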